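import Literature.AlgebraicGeometry.Motives.EllAdicCohomologyFinitenessFromProductsProofs
import Literature.AlgebraicGeometry.Motives.EllAdicComparisonProofs
import Literature.AlgebraicGeometry.Motives.ConstantProetSheaf
import Literature.AlgebraicGeometry.Motives.EllAdicCohomologyFinitenessEtale
import Literature.Algebra.Module.PadicIntStructure
import HarnessLib

/-!
# Finiteness of `ℓ`-adic cohomology, VIII: the residual obligation of
# `exists_addEquiv_geometricEllAdicCohomology` is Milne VI Cor. 2.8 for `ℤ/ℓ`, `ℓ` invertible,
# in positive degrees

`Literature.AlgebraicGeometry.Motives.exists_addEquiv_geometricEllAdicCohomology k`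
(`EllAdicCohomologyGroups.lean`) says: for `X` smooth projective geometrically irreducible over a
field `k`, `ℓ` a prime with `(ℓ : k) ≠ 0` and every `i`, `Hⁱ_proét(X_{k̄}, ℤ_ℓ) ≃+ ℤ_ℓ^b × T` with
`T` finite. After `EllAdicCohomologyFinitenessFromProductsProofs.lean` (Milne V Lemma 1.11, the
pro-étale `lim¹` sequence and the exactness of countable products on `Y_proét` all proved) it
rests on the named fact `finite_proetCohomology_zmod_of_isProper` alone — Milne VI Cor. 2.8 read
on the pro-étale site for **every** `n ≥ 1`, including `n` divisible by the characteristic, whose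
printed proof for `l = char k` is a separate theory (Artin–Schreier and the coherent finiteness
theorem, `EtaleArtinSchreier.lean`). The fact itself only concerns primes `ℓ` invertible in `k`.
This file proves, with no new named fact, that its residual proof obligation is correspondingly
smaller:

* `finite_proetCohomology_zmod_pow_of_zmod` — dévissage in the coefficients on `Y_proét`
  (Milne VI §2, proof of Thm. 2.1, "method of Step 3"), degree by degree: `Hʲ(Y_proét, ℤ/ℓ)`
  finite ⇒ `Hʲ(Y_proét, ℤ/ℓᵐ)` finite for all `m` (the general-site dévissage
  `finite_sheafH_constantSheaf_of_prime_dvd` of `EllAdicComparisonProofs.lean` transported along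
  Bhatt–Scholze Lemma 4.2.12, `proetCohomologyEquivConstantSheafH`);
* `module_finite_proetCohomology_padicInt_of_zmod_finite`,
  `exists_addEquiv_ellAdicCohomology_of_zmod_finite` — for any scheme `Y` and prime `ℓ` with all
  `Hʲ(Y_proét, ℤ/ℓ)` finite, `Hⁱ_proét(Y, ℤ_ℓ)` is a finitely generated `ℤ_ℓ`-module for its
  canonical structure (Milne V Lemma 1.11, proved form
  `module_finite_proetCohomology_padicInt_of_piComparison` +
  `bijective_piComparison_proetCohomology_holds`), hence `≃+ ℤ_ℓ^b × T`, `T` finite;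
* `exists_addEquiv_geometricEllAdicCohomology_of_ne_char` — **the fact from Milne VI Cor. 2.8 for
  `F = ℤ/(l)`, `l` invertible in `k = k_s`, `i ≥ 1`, read on `Y_proét`** (the explicit hypothesis
  `hQ`; degree `0` is the theorem `finite_proetCohomology_zmod_zero_of_isProper`): this is now the
  whole residual proof obligation of `exists_addEquiv_geometricEllAdicCohomology`;
* `exists_addEquiv_geometricEllAdicCohomology_of_etale_ne_char_of_acyclic` — equivalently, from
  the same statement on `Y_ét` (verbatim the hypothesis `hQ` of
  `finite_etaleCohomology_of_isProper_of_Ga_and_ne_char`, `EtaleArtinSchreierShortExactProofs.lean`: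
  the proper base change part of the printed proof of VI Thm. 2.1, Steps 5–6 for `l ≠ char k`)
  together with the acyclicity of `ν*I` for injective abelian étale sheaves `I` (verbatim the
  hypothesis `hc` of `EllAdicCohomologyFinitenessFromProductsProofs.lean`: the residual proof
  obligation of Bhatt–Scholze Cor. 5.1.6). Compared with
  `exists_addEquiv_geometricEllAdicCohomology_of_etale_finite_of_acyclic` there, the coherent
  finiteness theorem (`hfin`) and the Artin–Schreier sequence are no longer needed;
* `finite_proetCohomology_zmod_pos_ne_char_of_isProper_of` — the hypothesis `hQ` is a special
  case of the named fact `finite_proetCohomology_zmod_of_isProper` (nothing is strengthened).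

## References

* J. S. Milne, *Étale cohomology*, Princeton University Press (2025 reissue, held copy; PDF
  pages): V Lemma 1.11 (p. 177); VI Thm. 2.1 and its proof, Steps 3, 5, 6 (pp. 236–238);
  VI Cor. 2.8 (p. 238). [Milne2025]
* B. Bhatt, P. Scholze, *The pro-étale topology for schemes*, Astérisque 369 (2015): Lemma 4.2.12,
  Prop. 3.1.9–3.1.10, Lemma 5.1.2, Cor. 5.1.6, Prop. 5.6.2. [BhattScholze2015]
* P. Deligne, *La conjecture de Weil. I*, Publ. Math. IHÉS 43 (1974), (1.3). [Deligne1974]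

## Design notes

* Leaf file, theorems only; no `def … : Prop` (D-0026). Imports the discharge file
  `EllAdicCohomologyFinitenessFromProductsProofs.lean` (for
  `bijective_piComparison_proetCohomology_holds`, `full_faithful_etaleToProetPullback_holds` and
  `nonempty_addEquiv_proetCohomology_etaleCohomology_of_acyclic`).
* The hypothesis `hQ` quantifies over all `Y` proper over a separably closed field, as the printed
  theorem does; the proof uses it only for `Y = X_{k̄}` and the one prime `ℓ` of the statement
  (`(ℓ : k̄) ≠ 0` because `k → k̄` is injective).
-/

universe u

open CategoryTheory AlgebraicGeometry

noncomputable section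

namespace Literature.AlgebraicGeometry.Motives

/-! ### Dévissage `ℤ/ℓ ⇒ ℤ/ℓᵐ` on the pro-étale site -/

/-- **Dévissage in the coefficients on `Y_proét`** (Milne VI §2, proof of Thm. 2.1, method of
Step 3), one degree at a time: if `Hʲ(Y_proét, ℤ/ℓ)` is finite then so is `Hʲ(Y_proét, ℤ/ℓᵐ)` for
every `m ≥ 0`. Proof: `Hʲ(Y_proét, F_M) = Hʲ(Y_proét, M_Y)` for discrete `M` (Bhatt–Scholze
Lemma 4.2.12, `finite_proetCohomology_iff_finite_constantSheafH`), and on any site the finiteness of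
`Hʲ` with constant coefficients `M` follows from that with coefficients `ℤ/p` for the primes
`p ∣ |M|` (`finite_sheafH_constantSheaf_of_prime_dvd`); the only prime dividing `|ℤ/ℓᵐ| = ℓᵐ`
is `ℓ`. [cite: Milne2025, VI Thm. 2.1 (proof, Step 3)] [cite: BhattScholze2015, Lemma 4.2.12] -/
theorem finite_proetCohomology_zmod_pow_of_zmod (Y : Scheme.{u}) (ℓ : ℕ) [Fact ℓ.Prime] (j : ℕ)
    (h : Finite (ProetCohomology Y (ZMod ℓ) j)) (m : ℕ) :
    Finite (ProetCohomology Y (ZMod (ℓ ^ m)) j) := by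
  haveI : NeZero (ℓ ^ m) := ⟨pow_ne_zero m (Fact.out : ℓ.Prime).ne_zero⟩
  rw [finite_proetCohomology_iff_finite_constantSheafH]
  haveI : Finite (AddCommGrpCat.of (ULift.{u + 1} (ZMod (ℓ ^ m)))) :=
    inferInstanceAs (Finite (ULift.{u + 1} (ZMod (ℓ ^ m))))
  refine finite_sheafH_constantSheaf_of_prime_dvd (Scheme.ProEt.topology Y) j
    (AddCommGrpCat.of (ULift.{u + 1} (ZMod (ℓ ^ m)))) fun p _ hp => ?_
  have hcard : Nat.card (AddCommGrpCat.of (ULift.{u + 1} (ZMod (ℓ ^ m)))) = ℓ ^ m := by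
    change Nat.card (ULift.{u + 1} (ZMod (ℓ ^ m))) = ℓ ^ m
    rw [Nat.card_ulift, Nat.card_zmod]
  rw [hcard] at hp
  have hpℓ : p = ℓ :=
    (Nat.prime_dvd_prime_iff_eq Fact.out Fact.out).1 ((Fact.out : p.Prime).dvd_of_dvd_pow hp)
  subst hpℓ
  rwa [← finite_proetCohomology_iff_finite_constantSheafH]

/-! ### Milne V Lemma 1.11 for `Hⁱ_proét(Y, ℤ_ℓ)` from the finiteness of the `Hʲ(Y_proét, ℤ/ℓ)` -/

/-- **`Hⁱ_proét(Y, ℤ_ℓ)` is finitely generated over `ℤ_ℓ` when all `Hʲ(Y_proét, ℤ/ℓ)` are finite**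
(any scheme `Y`, canonical `ℤ_ℓ`-module structure `ProetCohomology.instModulePadicInt`): Milne V
Lemma 1.11 in its proved pro-étale form (`module_finite_proetCohomology_padicInt_of_piComparison`
with `bijective_piComparison_proetCohomology_holds`, Bhatt–Scholze Prop. 3.1.9–3.1.10), fed with the
dévissage `finite_proetCohomology_zmod_pow_of_zmod`. [cite: Milne2025, V Lemma 1.11]
[cite: BhattScholze2015, Prop. 3.1.9–3.1.10 and Prop. 5.6.2] -/
theorem module_finite_proetCohomology_padicInt_of_zmod_finite (Y : Scheme.{u}) (ℓ : ℕ)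
    [Fact ℓ.Prime] (h : ∀ j : ℕ, Finite (ProetCohomology Y (ZMod ℓ) j)) (i : ℕ) :
    Module.Finite ℤ_[ℓ] (ProetCohomology Y ℤ_[ℓ] i) :=
  module_finite_proetCohomology_padicInt_of_piComparison Y ℓ
    bijective_piComparison_proetCohomology_holds
    (fun m j => finite_proetCohomology_zmod_pow_of_zmod Y ℓ j (h j) m) i

/-- Hence, as a group, **`Hⁱ_proét(Y, ℤ_ℓ) ≃+ ℤ_ℓ^b × T` with `T` finite** whenever all
`Hʲ(Y_proét, ℤ/ℓ)` are finite (structure theorem over the PID `ℤ_ℓ`,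
`Literature.Algebra.Module.PadicInt.exists_addEquiv_prod_finite_of_exists`); here
`Y.EllAdicCohomology ℓ i` is Mathlib's group (`= ProetCohomology Y ℤ_[ℓ] i` by `rfl`).
[cite: Milne2025, V Lemma 1.11] -/
theorem exists_addEquiv_ellAdicCohomology_of_zmod_finite (Y : Scheme.{u}) (ℓ : ℕ) [Fact ℓ.Prime]
    (h : ∀ j : ℕ, Finite (ProetCohomology Y (ZMod ℓ) j)) (i : ℕ) :
    ∃ (b : ℕ) (T : Type) (_ : AddCommGroup T) (_ : Finite T),
      Nonempty (Y.EllAdicCohomology ℓ i ≃+ (Fin b → ℤ_[ℓ]) × T) :=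
  Literature.Algebra.Module.PadicInt.exists_addEquiv_prod_finite_of_exists ℓ _
    ⟨ellAdicCohomologyModule Y ℓ i, module_finite_proetCohomology_padicInt_of_zmod_finite Y ℓ h i⟩

/-! ### The residual obligation of `exists_addEquiv_geometricEllAdicCohomology` -/

/-- **`exists_addEquiv_geometricEllAdicCohomology k` from Milne VI Cor. 2.8 for `ℤ/ℓ`, `ℓ`
invertible, in positive degrees, on the pro-étale site.** Hypothesis `hQ` — stated explicitly,
not a named fact of the tree (D-0026) — is: for `K` separably closed, `Y → Spec K` proper, `ℓ` a
prime with `(ℓ : K) ≠ 0` and `i ≥ 1`, `Hⁱ(Y_proét, ℤ/ℓ)` is finite (VI Cor. 2.8, p. 238, for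
`k = k_s`, `F = ℤ/(l)` with `l` invertible — the case of VI Thm. 2.1 proved in Steps 5–6 from
the cohomology of curves, `|Hⁱ(Y_x, ℤ/(l))| = l, l^{2g}, l, 1`, and Artin's reduction to relative
dimension `≤ 1` — read on `Y_proét` through Bhatt–Scholze Cor. 5.1.6 / Lemma 4.2.12). Conclusion:
the named fact, for every field `k`. Real proof: `X_{k̄}` is proper over the algebraically closed
`k̄` (`IsSmoothProjective.baseChange_obj`, `isProper_holds`), `(ℓ : k̄) ≠ 0` as `k → k̄` is
injective, degree `0` is the theorem `finite_proetCohomology_zmod_zero_of_isProper`, and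
`exists_addEquiv_ellAdicCohomology_of_zmod_finite` (Milne V.1.11, dévissage, structure theorem,
all proved). This replaces `finite_proetCohomology_zmod_of_isProper` (all `n ≥ 1`, including
`char k ∣ n`) as the residual proof obligation of the fact.
[cite: Milne2025, VI Cor. 2.8, VI Thm. 2.1 (proof, Steps 3, 5, 6) and V Lemma 1.11]
[cite: BhattScholze2015, Cor. 5.1.6 and Lemma 4.2.12] [cite: Deligne1974, (1.3)] -/
theorem exists_addEquiv_geometricEllAdicCohomology_of_ne_char
    (hQ : ∀ (K : Type u) [Field K] [IsSepClosed K] (Y : Scheme.{u}) (f : Y ⟶ Spec (.of K))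
      [IsProper f] (ℓ : ℕ) [Fact ℓ.Prime], (ℓ : K) ≠ 0 → ∀ (i : ℕ), 0 < i →
      Finite (ProetCohomology Y (ZMod ℓ) i))
    (k : Type u) [Field k] :
    exists_addEquiv_geometricEllAdicCohomology k := by
  intro n X hX ℓ _ hℓ i
  have hY : IsSmoothProjective n ((baseChange k (AlgebraicClosure k)).obj X) :=
    hX.baseChange_obj (AlgebraicClosure k)
  haveI : IsProper ((baseChange k (AlgebraicClosure k)).obj X).hom :=
    IsSmoothProjective.isProper_holds hY
  have hℓ' : (ℓ : AlgebraicClosure k) ≠ 0 := by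
    intro h
    apply hℓ
    apply (algebraMap k (AlgebraicClosure k)).injective
    rw [map_natCast, h, map_zero]
  refine exists_addEquiv_ellAdicCohomology_of_zmod_finite _ ℓ (fun j => ?_) i
  cases j with
  | zero =>
    exact finite_proetCohomology_zmod_zero_of_isProper
      ((baseChange k (AlgebraicClosure k)).obj X).hom ℓ
  | succ j =>
    exact hQ (AlgebraicClosure k) _ ((baseChange k (AlgebraicClosure k)).obj X).hom ℓ hℓ'
      (j + 1) j.succ_pos

/-- **`exists_addEquiv_geometricEllAdicCohomology k` from Milne VI Cor. 2.8 for `ℤ/ℓ`, `ℓ`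
invertible, in positive degrees, on the étale site, and the acyclicity of `ν*I`.** Hypothesis
`hQ` is verbatim the hypothesis `hQ` of `finite_etaleCohomology_of_isProper_of_Ga_and_ne_char`
(`EtaleArtinSchreierShortExactProofs.lean`): for `K` separably closed, `Y → Spec K` proper, `ℓ`
prime with `(ℓ : K) ≠ 0`, `i ≥ 1`, Mathlib's `Hⁱ(Y_ét, ℤ/ℓ)` (`Sheaf.H` of the constant sheaf on
`Y.Etale`) is finite (VI Cor. 2.8 / Thm. 2.1, Steps 5–6, case `l ≠ char k`). Hypothesis `hc` is
verbatim the hypothesis `hc` of `EllAdicCohomologyFinitenessFromProductsProofs.lean`: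
`Hᵖ⁺¹(X_proét, ν*I) = 0` for `I` injective on `X_ét` (the residual proof obligation of
Bhatt–Scholze Cor. 5.1.6, Lemma 5.1.2 being proved), which gives the bridge
`Hⁱ(Y_proét, ℤ/n) ≃+ Hⁱ(Y_ét, ℤ/n)` (`nonempty_addEquiv_proetCohomology_etaleCohomology_of_acyclic`).
Neither the coherent finiteness theorem nor the Artin–Schreier sequence (the case `l = char k`)
is needed for the fact. [cite: Milne2025, VI Cor. 2.8 and V Lemma 1.11]
[cite: BhattScholze2015, Cor. 5.1.6 and Lemma 5.1.2] -/
theorem exists_addEquiv_geometricEllAdicCohomology_of_etale_ne_char_of_acyclic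
    (hQ : ∀ (K : Type u) [Field K] [IsSepClosed K] (Y : Scheme.{u}) (f : Y ⟶ Spec (.of K))
      [IsProper f] (ℓ : ℕ) [Fact ℓ.Prime], (ℓ : K) ≠ 0 → ∀ (i : ℕ), 0 < i →
      Finite (((constantSheaf Y.smallEtaleTopology Ab.{u}).obj
        (AddCommGrpCat.of (ULift.{u} (ZMod ℓ)))).H i : Type u))
    (hc : ∀ (X : Scheme.{u}) (I : Sheaf X.smallEtaleTopology Ab.{u}), Injective I →
      ∀ p : ℕ, Subsingleton (((etaleToProetPullbackULift X).obj I).H (p + 1)))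
    (k : Type u) [Field k] :
    exists_addEquiv_geometricEllAdicCohomology k := by
  refine exists_addEquiv_geometricEllAdicCohomology_of_ne_char (fun K _ _ Y f _ ℓ _ hℓ i hi => ?_) k
  obtain ⟨e⟩ := nonempty_addEquiv_proetCohomology_etaleCohomology_of_acyclic hc Y ℓ i
  haveI := hQ K Y f ℓ hℓ i hi
  exact Finite.of_equiv _ e.symm.toEquiv

/-- The hypothesis `hQ` of `exists_addEquiv_geometricEllAdicCohomology_of_ne_char` is a special
case of the named fact `finite_proetCohomology_zmod_of_isProper` (Milne VI Cor. 2.8 on `Y_proét`,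
all `n ≥ 1`, all degrees): nothing has been strengthened. [cite: Milne2025, VI Cor. 2.8] -/
theorem finite_proetCohomology_zmod_pos_ne_char_of_isProper_of
    (hB : finite_proetCohomology_zmod_of_isProper.{u}) :
    ∀ (K : Type u) [Field K] [IsSepClosed K] (Y : Scheme.{u}) (f : Y ⟶ Spec (.of K))
      [IsProper f] (ℓ : ℕ) [Fact ℓ.Prime], (ℓ : K) ≠ 0 → ∀ (i : ℕ), 0 < i →
      Finite (ProetCohomology Y (ZMod ℓ) i) := by
  intro K _ _ Y f _ ℓ _ _ i _
  haveI : NeZero ℓ := ⟨(Fact.out : ℓ.Prime).ne_zero⟩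
  exact hB f ℓ i

end Literature.AlgebraicGeometry.Motives

end
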